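import Summits.QuantumFields.BalabanUV.Beta.GAN24.FibreStripJM
import Summits.QuantumFields.BalabanUV.Beta.GAN24.StripLegUnitsJM
import Summits.QuantumFields.BalabanUV.Beta.GAN24.FibreStrip

/-!
# `BalabanUV.Beta.GAN24.FibreStripJMHolds` — binder row G-an2-4 ∕ (CONV-C), lineage gan24-p3 (part P3, Woodbury ∕ fibre layer):
# **ROAD P1's (I3′) HOLDS AT EVERY RELATIVE BLOCKING `Lc^m` IN DIMENSION FOUR** — `∃ κ > 0, ∃ Cst, FibreStripJM.StripRegularKM 3 Lc m κ Cst` for every `Lc ≥ 1` and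
# every `m`, hence the `j`-UNIFORM `Decays` bound of the unit-rescaled (j, m)-resolvents `unitK (sfStep Lc j) (smStep 3 Lc j) (KTot (Lc^(j+m)) (Lc^j))`
# (the binder `hK` of road FP's N5b-2 `FP.TransportInfinityM.entryHyps_perfCol` ∕ `FP.SymmetryK.kernelSide_KPerf` at relative blocking `Lc^m`)

NOT IN PRINT; OUR PROOF.  HONEST FRAMING (cell contract, verbatim): «discharging `BetaPertH` makes Bałaban's UV stability UNCONDITIONAL — a real constructive-QFT
result; it is NOT the continuum limit and NOT the Clay problem.»  HONEST DEPENDENCY (verbatim): «continuum YM on T⁴ ⇐ BetaPertH ∧ nine spine estimates (0/9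
proved); BetaPertH ⇐ (D1) ∧ (D4) ∧ CAP+tail; G-an2-4 gates asym, D1 and NE2/3/4.»

THE OBSERVATION (why this is M-sized).  Road P1's (I3′) = (U1) ∧ (U2): (U1) — no zero of the Bloch-fibre determinant of the U = 1 KKT stencil on the strip and the
scaled a-priori bound of the alias arrow matrix — is a statement about the FINE blocking `N` ALONE, and its tree form `FibreDetStrip.apriori_of_rows` ∕
`det_ne_zero_of_rows` is ONE-`N` generic, as are the four rows it consumes (F3 `ArrowAnchorZero.isUnit_innerArrow_zero`, F4 `ArrowInnerShift.exists_cIn`, F5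
`ArrowAnchorReal.arrowAnchorReal`, F6 `ArrowOuterShift.outerLipschitz`) and the radii `FibreDetStripOfAnchors.exists_radii`: instantiate at `N := Lc^(j+m)`.  Only (U2) —
the readout of the decimated legs at `M = Lc^j`, whose unit bookkeeping couples `N` and `M` — needs re-running, and `GAN24/StripLegUnitsJM` shows that in the adopted
units the level `j` CANCELS against the cut's scaling at every ratio `N∕M = Lc^m`, leaving road P1's constant `StripLegUnits.cstSq A η (Lc^m) r₀` (hence
`FibreStripOfRows.cstU aR κ (Lc^m) ρ₀`) — `j`-FREE.

CONTENT (`d = 3`; every `Lc ≥ 1`, every `m ≥ 0`; [our object] ∕ [folklore]):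
* §1 `legBound_jm_of_inv_bound`: (U2) at one strip point from an inverse bound of the scaled arrow matrix at `N = Lc^(j+m)` (weights `FibreStripOfRows.sigR∕rhoR` DISCHARGED).
* §2 **`stripRegularKM_of_rows`**: the shape as a FUNCTION of rows F4∕F5∕F6 at the blockings `Lc^(j+m)` (F3 plugged, `aZ = 5/2`) — `FibreStripOfRows.fibreStrip_of_rows`
  re-run with (U1) at `N := Lc^(j+m)` and (U2) from `StripLegUnitsJM`; **`stripRegularKM_holds : ∃ κ, 0 < κ ∧ ∃ Cst, StripRegularKM 3 Lc m κ Cst`** (rows BY NAME, as in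
  `FibreStrip.fibreStrip`).
* §3 **`uniformDecaysKM_holds`**: `∃ κ > 0, ∃ Cst, UniformDecays (j ↦ unitK (sfStep Lc j) (smStep 3 Lc j) (KTot (Lc^(j+m)) (Lc^j))) (Cst·e^{2κ}) (κ∕((3+1)·Lc^m))` —
  `FibreStripJM.uniformDecays_of_stripRegularKM`; at `m = 1` this is road P1's `FibreStrip.unitDecayK_holds` (same rows, same route), for `m ≥ 2` it is NEW.
HONEST: the `j`-uniform decay of the (j, m)-family (K-side, `hK`) only; the Cauchy currency `hKall` and the discharges are `GAN24/KSlotJMHolds`; X1m-S∕W, N0b-K's alias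
closed form, the wall's W-pin UNTOUCHED; 0 wall binders instantiated; NEVER «G-an2-4 closed», NOT BetaPertH, NOT continuum, NOT Clay.

ABSOLUTE RULE (cell, verbatim): «No internally-minted statement may enter as a cited fact. Every hypothesis is either kernel-proved in this package or a
verbatim quotation of a PUBLISHED theorem with page reference.»  Nothing is cited; no `def`; every input is a tree theorem imported BY NAME.
-/

noncomputable section

open Matrix Complex Finset
open scoped Matrix.Norms.L2Operator Real BigOperators
open Literature.MathematicalPhysics.QuantumFieldTheory
open Literature.MathematicalPhysics.QuantumFieldTheory.Balaban1983to89
open Literature.MathematicalPhysics.QuantumFieldTheory.Balaban1983to89.Beta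
open Literature.MathematicalPhysics.QuantumFieldTheory.LatticeForm (quo repZ)
open Literature.Probability.LatticeModels (TorusSite)
open B4Strip (Strip reVec ofRealVec)
open B4ContourShift (BZ)
open BlochFibreMatrix (stencil pieceMatrix)
open FibreInverseDecay (trigPolySymbol reVec_mem_BZ)
open ExpKernelCalculus (Decays)
open OneStepResolventKernel (Fib)
open Summit.QuantumFields.BalabanUV.Beta.HessKerDressedUnits (unitK)
open Summit.QuantumFields.BalabanUV.Beta.GAN24.CombesThomas (sfStep smStep UniformDecays)
open Summit.QuantumFields.BalabanUV.Beta.GAN24.CombesThomasFibreStep (kFibW)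
open Summit.QuantumFields.BalabanUV.Beta.GAN24.ArrowOperator
open Summit.QuantumFields.BalabanUV.Beta.GAN24.ArrowScaling
open Summit.QuantumFields.BalabanUV.Beta.GAN24.ArrowAnchorZero (isUnit_innerArrow_zero)
open Summit.QuantumFields.BalabanUV.Beta.GAN24.FibreDetStripOfAnchors (exists_radii)
open Summit.QuantumFields.BalabanUV.Beta.GAN24.FibreDetStrip (apriori_of_rows det_ne_zero_of_rows abs_le_pi_of_mem_BZ)
open Summit.QuantumFields.BalabanUV.Beta.GAN24.StripLegUnits (cstSq cstSq_nonneg cstSq_mono)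
open Summit.QuantumFields.BalabanUV.Beta.GAN24.StripLegUnitsJM (norm_kFibW_jm_le_sqrt_cstSq)
open Summit.QuantumFields.BalabanUV.Beta.GAN24.FibreStripOfRows (sigR rhoR sigR_pos sigR_A sigR_phi rhoR_EL rhoR_Q apriori_sq_of_inv_bound radI_hyps radO_hyps
  radO_zero_le le_radO_zero cstU)
open Summit.QuantumFields.BalabanUV.Beta.GAN24.FibreStrip (omegaOut OmegaOut omegaOut_le OmegaOut_nonneg cOut4 cOut4_nonneg)
open Summit.QuantumFields.BalabanUV.Beta.GAN24.FibreStripJM (kFibΔM StripRegularKM kFibΔM_repZ_eq_kFibW stripRegularKM_of_repZ stripRegular_kFibΔM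
  uniformDecays_of_stripRegularKM)
open Summit.QuantumFields.BalabanUV.Beta.FP.PerfectObjects (KTot)

namespace Summit.QuantumFields.BalabanUV.Beta.GAN24.FibreStripJMHolds

variable {Lc : ℕ} [NeZero Lc]

/-! ## §1 (U2) at one strip point from an inverse bound of the scaled arrow matrix at `N = Lc^(j+m)` -/

/-- [folklore] `1 ≤ Lc^(j+m)`. -/
theorem one_le_pow_add (j m : ℕ) : 1 ≤ Lc ^ (j + m) := Nat.one_le_pow _ _ (Nat.pos_of_ne_zero (NeZero.ne Lc))

/-- [folklore] **(U2) AT ONE POINT, RELATIVE BLOCKING `Lc^m`**: on `|Im p_i| ≤ η ≤ 1/4`, `|Re p_i| ≤ π`, an inverse bound `A` of the scaled arrow matrix at `N = Lc^(j+m)` with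
radii `r` (`r_n² ≥ 4` off the zero alias, `r 0 = r₀ > 0`) gives `‖kFibW (Lc^(j+m)) (Lc^j) (sfStep Lc j) (smStep 3 Lc j) a (repZ zx) b (repZ zy) p‖ ≤ √(cstSq A η (Lc^m) r₀)`
(`StripLegUnitsJM.norm_kFibW_jm_le_sqrt_cstSq` with the cut's weights `sigR∕rhoR` discharged — `FibreStripOfRows.legBound_of_inv_bound` at ratio `Lc^m`). -/
theorem legBound_jm_of_inv_bound {η A r0 : ℝ} (hη : 0 ≤ η) (hη4 : η ≤ 1 / 4) (m j : ℕ) {p : Fin 4 → ℂ}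
    (him : ∀ i, |(p i).im| ≤ η) (hre : ∀ i, |(p i).re| ≤ π)
    (r : TorusSite 4 (Lc ^ (j + m)) → ℝ) (hr : ∀ n, 0 < r n) (hr4 : ∀ n, n ≠ 0 → 4 ≤ r n ^ 2) (hr0 : 0 < r0) (hr00 : r 0 = r0)
    (hU : IsUnit (arrowMat (scaledArrow (Lc ^ (j + m)) r r0 p))) (hA : ‖(arrowMat (scaledArrow (Lc ^ (j + m)) r r0 p))⁻¹‖ ≤ A)
    (a b : Fib 3) (zx zy : TorusSite 4 (Lc ^ m)) :
    ‖kFibW (Lc ^ (j + m)) (Lc ^ j) (sfStep Lc j) (smStep 3 Lc j) a (repZ zx) b (repZ zy) p‖ ≤ Real.sqrt (cstSq A η (Lc ^ m) r0) := by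
  have hN : (((Lc ^ (j + m) : ℕ) : ℝ)) = (Lc : ℝ) ^ (j + m) := Nat.cast_pow Lc (j + m)
  refine norm_kFibW_jm_le_sqrt_cstSq hη hη4 hr0 m j him hre (sigR (Lc ^ (j + m)) r r0) (rhoR (Lc ^ (j + m)) r r0) (sigR_pos hr hr0)
    (fun n κ => by rw [sigR_A]) (fun κ => by rw [sigR_phi, hN]) (fun κ => ?_) (fun n hn κ => ?_) (fun κ => ?_)
    (apriori_sq_of_inv_bound hr hr0 p hU hA) a b zx zy
  · rw [rhoR_EL, hr00, hN, abs_of_nonneg (by positivity)]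
  · rw [rhoR_EL, hN, abs_of_nonneg (by positivity)]
    exact div_le_div_of_nonneg_left (by positivity) (by norm_num) (hr4 n hn)
  · rw [rhoR_Q, hN, abs_of_nonneg (by positivity)]

/-! ## §2 (I3′) at relative blocking `Lc^m` as a function of rows F4∕F5∕F6, and unconditionally -/

/-- [folklore] **`StripRegularKM 3 Lc m κ Cst` AS A FUNCTION OF ROWS F4 ∕ F5 ∕ F6 AT THE BLOCKINGS `Lc^(j+m)`** (binder shapes EXACTLY those of
`FibreDetStrip.det_ne_zero_of_rows` ∕ `apriori_of_rows` at `N := Lc^(j+m)`, F3 = `ArrowAnchorZero.isUnit_innerArrow_zero` plugged, `aZ = 5/2`): there are `κ > 0` and `Cst`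
with `StripRegularKM 3 Lc m κ Cst` — `FibreStripOfRows.fibreStrip_of_rows` at relative blocking `Lc^m` ((U1) one-`N` generic; (U2) by §1). -/
theorem stripRegularKM_of_rows {aR cIn cOut ρ₁ η₁ : ℝ} (ω : (Fin 4 → ℝ) → ℝ) (Ω : ℝ → ℝ) (m : ℕ)
    (hF4 : ∀ (j : ℕ) (p : Fin (3 + 1) → ℂ) (r : ℝ), (∀ μ, ‖p μ‖ ≤ r) → r ≤ ρ₁ →
      ‖arrowMat (innerArrow (Lc ^ (j + m)) p) - arrowMat (innerArrow (Lc ^ (j + m)) 0)‖ ≤ cIn * r)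
    (hF5 : ∀ (j : ℕ), ∀ q ∈ BZ (3 + 1), q ≠ 0 → IsUnit (arrowMat (outerArrow (Lc ^ (j + m)) q (ofRealVec q))) ∧
      ‖(arrowMat (outerArrow (Lc ^ (j + m)) q (ofRealVec q)))⁻¹‖ ≤ aR)
    (hF6 : ∀ (j : ℕ), ∀ q ∈ BZ (3 + 1), q ≠ 0 → ∀ p : Fin (3 + 1) → ℂ, reVec p = q → ∀ η : ℝ, 0 ≤ η → η ≤ η₁ → (∀ μ, |(p μ).im| ≤ η) →
      ‖arrowMat (outerArrow (Lc ^ (j + m)) q p) - arrowMat (outerArrow (Lc ^ (j + m)) q (ofRealVec q))‖ ≤ cOut * η * ω q)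
    (hω : ∀ ρ₀ : ℝ, 0 < ρ₀ → ∀ q ∈ BZ (3 + 1), (∃ μ, ρ₀ / 2 ≤ |q μ|) → ω q ≤ Ω ρ₀) (hΩ : ∀ ρ, 0 < ρ → 0 ≤ Ω ρ)
    (haR : 0 ≤ aR) (hcIn : 0 ≤ cIn) (hcOut : 0 ≤ cOut) (hρ₁ : 0 < ρ₁) (hη₁ : 0 < η₁) :
    ∃ κ, 0 < κ ∧ ∃ Cst, StripRegularKM 3 Lc m κ Cst := by
  have hF3 : ∀ j : ℕ, IsUnit (arrowMat (innerArrow (Lc ^ (j + m)) (0 : Fin (3 + 1) → ℂ))) ∧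
      ‖(arrowMat (innerArrow (Lc ^ (j + m)) (0 : Fin (3 + 1) → ℂ)))⁻¹‖ ≤ 5 / 2 := fun j => isUnit_innerArrow_zero
  have haZ : (0 : ℝ) ≤ 5 / 2 := by norm_num
  obtain ⟨ρ₀, κ₀, hρ₀, hρ, hsmallIn, hκ₀, hκ, hκη, hsmallOut⟩ := exists_radii Ω haZ haR hcIn hcOut hρ₁ hη₁ hΩ
  set κ : ℝ := min κ₀ (1 / 4) with hκdef
  have hκpos : 0 < κ := lt_min hκ₀ (by norm_num)
  have hκle : κ ≤ κ₀ := min_le_left _ _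
  have hκ4 : κ ≤ 1 / 4 := min_le_right _ _
  have hmono : ∀ p : Fin (3 + 1) → ℂ, p ∈ Strip (3 + 1) κ → p ∈ Strip (3 + 1) κ₀ := fun p hp μ => ⟨(hp μ).1, (hp μ).2.trans hκle⟩
  -- (U1) at the fine blocking `N = Lc^(j+m)`: one-`N` generic
  have hU1 : ∀ j, ∀ p ∈ Strip (3 + 1) κ₀, (trigPolySymbol (stencil (3 + 1)) (pieceMatrix (N := Lc ^ (j + m))) p).det ≠ 0 := fun j =>
    det_ne_zero_of_rows (N := Lc ^ (j + m)) ω (hF3 j) (hF4 j) (hF5 j) (hF6 j) (hω ρ₀ hρ₀) haZ haR hcOut hρ₀ hρ hsmallIn hκ₀.le hκ hκη hsmallOut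
  -- (U2) at `(N, M) = (Lc^(j+m), Lc^j)`
  have hU2 : ∀ (j : ℕ) (zx zy : TorusSite (3 + 1) (Lc ^ m)) (a b : Fib 3), ∀ p ∈ Strip (3 + 1) κ,
      ‖kFibΔM Lc (sfStep Lc) (smStep 3 Lc) m j a (repZ zx) b (repZ zy) p‖ ≤ cstU aR κ (Lc ^ m) ρ₀ := by
    intro j zx zy a b p hp
    have him : ∀ i, |(p i).im| ≤ κ := fun i => (hp i).2
    have hre : ∀ i, |(p i).re| ≤ π := fun i => (hp i).1
    rw [kFibΔM_repZ_eq_kFibW]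
    rcases apriori_of_rows (N := Lc ^ (j + m)) ω (hF3 j) (hF4 j) (hF5 j) (hF6 j) (hω ρ₀ hρ₀) haZ haR hcOut hρ₀ hρ hsmallIn hκ₀.le hκ hκη
        hsmallOut (hmono p hp) with ⟨-, hU, hA⟩ | ⟨hfar, hq0, hU, hA⟩
    · -- inner case: radii `radI`, `r₀ = 1`, `A = 2·(5/2)`
      obtain ⟨hr, hr4, hr00⟩ := radI_hyps (N := Lc ^ (j + m))
      exact (legBound_jm_of_inv_bound hκpos.le hκ4 m j him hre (radI (Lc ^ (j + m))) hr hr4 one_pos hr00 hU hA a b zx zy).trans (le_max_left _ _)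
    · -- outer case: anchor `q = reVec p ∈ BZ ∖ {0}`, radii `radO N q`, `r₀ = radO N q 0 ∈ [ρ₀/π, 2π]`, `A = 2·aR`
      have hq : reVec p ∈ BZ (3 + 1) := reVec_mem_BZ hp
      obtain ⟨hr, hr4⟩ := radO_hyps (N := Lc ^ (j + m)) hq hq0
      have h1 := legBound_jm_of_inv_bound hκpos.le hκ4 m j him hre (radO (Lc ^ (j + m)) (reVec p)) hr hr4 (hr 0) rfl hU hA a b zx zy
      refine h1.trans ((Real.sqrt_le_sqrt ?_).trans (le_max_right _ _))
      have hlo : ρ₀ / π ≤ radO (Lc ^ (j + m)) (reVec p) 0 := le_radO_zero hq hρ₀ hfar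
      have hhi : radO (Lc ^ (j + m)) (reVec p) 0 ≤ 2 * π := radO_zero_le hq
      exact cstSq_mono (A := 2 * aR) (η := κ) (Lc := Lc ^ m) (by positivity) hlo hhi
  refine ⟨κ, hκpos, cstU aR κ (Lc ^ m) ρ₀, stripRegularKM_of_repZ fun j zx zy a b => ?_⟩
  exact stripRegular_kFibΔM hκpos.le _ _ m j (fun p hp => hU1 j p (hmono p hp)) a (repZ zx) b (repZ zy) (hU2 j zx zy a b)

/-- **(I3′) AT RELATIVE BLOCKING `Lc^m` HOLDS** [our proof] (`d = 3`, every `Lc ≥ 1`, every `m`): `∃ κ > 0, ∃ Cst, StripRegularKM 3 Lc m κ Cst`.  Rows: F4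
`ArrowInnerShift.exists_cIn`, F5 `ArrowAnchorReal.arrowAnchorReal`, F6 `ArrowOuterShift.outerLipschitz` (+ F3, radii, (U1), (U2)) — all BY NAME, instantiated at `N := Lc^(j+m)`;
at `m = 1` the same route is road P1's `FibreStrip.fibreStrip`. -/
theorem stripRegularKM_holds (m : ℕ) : ∃ κ, 0 < κ ∧ ∃ Cst, StripRegularKM 3 Lc m κ Cst := by
  obtain ⟨cIn, hcIn, hF4⟩ := ArrowInnerShift.exists_cIn 3
  refine stripRegularKM_of_rows (Lc := Lc) (aR := ArrowAnchorReal.aR 4) (cIn := cIn) (cOut := cOut4) (ρ₁ := 1 / 2) (η₁ := 1) omegaOut OmegaOut m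
    (fun j p r hp hr => hF4 (Lc ^ (j + m)) p r hp hr)
    (fun j q hq hq0 => ArrowAnchorReal.arrowAnchorReal (N := Lc ^ (j + m)) (one_le_pow_add j m) (abs_le_pi_of_mem_BZ hq) hq0)
    (fun j q hq hq0 p hpq η hη0 hη1 him => ?_)
    (fun ρ₀ hρ₀ q _ hfar => omegaOut_le hρ₀ q hfar) OmegaOut_nonneg (le_of_lt (ArrowAnchorReal.aR_pos 4)) hcIn cOut4_nonneg
    (by norm_num) one_pos
  have h := ArrowOuterShift.outerLipschitz (D := 4) (N := Lc ^ (j + m)) (one_le_pow_add j m) q hq hq0 p hpq η hη0 hη1 him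
  simpa only [cOut4, omegaOut, Nat.cast_ofNat] using h

/-! ## §3 The `j`-uniform decay of the (j, m)-resolvent family — unconditional -/

/-- **THE `j`-UNIFORM `Decays` BOUND OF THE UNIT-RESCALED (j, m)-RESOLVENTS — UNCONDITIONAL** [our proof] (`d = 3`, every `Lc ≥ 1`, every `m`):
`∃ κ > 0, ∃ Cst, UniformDecays (j ↦ unitK (sfStep Lc j) (smStep 3 Lc j) (KTot (Lc^(j+m)) (Lc^j))) (Cst·e^{2κ}) (κ∕((3+1)·Lc^m))` — the binder `hK` of
`FP.TransportInfinityM.entryHyps_perfCol` ∕ `FP.SymmetryK.kernelSide_KPerf` at relative blocking `Lc^m`, adopted units. -/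
theorem uniformDecaysKM_holds (m : ℕ) : ∃ κ, 0 < κ ∧ ∃ Cst,
    UniformDecays (fun j => unitK (sfStep Lc j) (smStep 3 Lc j) (KTot (d := 3) (Lc ^ (j + m)) (Lc ^ j)))
      (Cst * Real.exp (2 * κ)) (κ / ((3 + 1) * (Lc : ℝ) ^ m)) := by
  obtain ⟨κ, hκ, Cst, h⟩ := stripRegularKM_holds (Lc := Lc) m
  exact ⟨κ, hκ, Cst, uniformDecays_of_stripRegularKM hκ.le h⟩

/-- [our proof] The same in bare `∀ j, Decays …` form with the nonnegativity of the constant displayed. -/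
theorem exists_decays_KTot_uniform (m : ℕ) : ∃ δ C : ℝ, 0 < δ ∧ 0 ≤ C ∧
    ∀ j, Decays (unitK (sfStep Lc j) (smStep 3 Lc j) (KTot (d := 3) (Lc ^ (j + m)) (Lc ^ j))) C δ := by
  obtain ⟨κ, hκ, Cst, h⟩ := uniformDecaysKM_holds (Lc := Lc) m
  have hLm : (0 : ℝ) < (Lc : ℝ) ^ m := pow_pos (by exact_mod_cast Nat.pos_of_ne_zero (NeZero.ne Lc)) m
  exact ⟨_, _, div_pos hκ (by positivity), (h 0).nonneg (Sum.inl 0), h⟩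

end Summit.QuantumFields.BalabanUV.Beta.GAN24.FibreStripJMHolds

end
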